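import Summits.AtomisticToContinuum.Crystallization.Theses.DisclinationRation
import Summits.AtomisticToContinuum.Crystallization.Theorems.HullExactificationCascadeHullGoodEverywhereDense
import Summits.AtomisticToContinuum.Crystallization.Theorems.GappedShellCensusCleanLimitsHaveWindowsDefectLipschitz
import HarnessLib

/-!
# Stub `stub_alphabetGoodRelDense` of line `birth`, crux `AlphabetGoodHullElement`
# (route `DisclinationRation`, item stmt-AtomisticToContinuum-15798)

EVERYWHERE-ALPHABET-GOOD SETS WITH BOUNDED SCALE ARE RELATIVELY DENSE.  A non-empty `δ`-separated
`S ⊆ ℝ³` every point `y` of which is alphabet-good (its rescaled strict `13/10 · d_y` shell is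
`1/20`-matched, through a bijection and a linear isometry, to `fccKissingPattern`,
`hcpKissingPattern` or the twelve-point decahedral-axis pattern
`{±e₃} ∪ {(√3/2·cos(2πk/5), √3/2·sin(2πk/5), ±1/2)}`) with local scale `d_y ≤ R₀` has a point
within `4 R₀` of every point of `ℝ³`.

This is `hge_relDense` of `…HullGoodEverywhereDense` re-run with a third pattern: the closest point
`y ∈ S` to `p` exists by local finiteness and, if `dist y p > 4 R₀`, one of its shell points is
strictly closer (`hge_exists_closer`, generic in a `Finset` pattern of unit vectors that sees every
direction in the weak sense `∀ u, ∃ v ∈ P, ‖u‖ ≤ 5 ⟪u, v⟫`).  The only new work is the decahedral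
pattern: it is a finite set of unit vectors (`agrd_dec_finset`), and it sees every direction
(`agrd_dec_cover`: the two poles bound `|u₂|`, the ring directions at angles `0`, `4π/5`, `6π/5`
bound the planar part, through `cos (π/5) = (1 + √5)/4`).  Coordinates of explicit vectors:
`CleanHull.dl_norm_sq_vec3` (landed, `…CleanLimitsHaveWindowsDefectLipschitz`) and `hge_norm_sq`.
-/

noncomputable section

namespace Summit.AtomisticToContinuum.Crystallization.Theorems.AlphabetGoodHullElementBirth

open Summit.AtomisticToContinuum.Crystallization.Theorems
open Literature.MathematicalPhysics.StatisticalMechanics Literature.Geometry.DiscreteGeometry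
open Filter Topology Metric RealInnerProductSpace

/-! ## Coordinates of explicit vectors -/

/-- `⟪u, (a, b, c)⟫ = u₀ a + u₁ b + u₂ c`. [folklore] -/
theorem agrd_inner_vec3 (u : EuclideanSpace ℝ (Fin 3)) (a b c : ℝ) :
    ⟪u, !₂[a, b, c]⟫ = u 0 * a + u 1 * b + u 2 * c := by
  simp [PiLp.inner_apply, Fin.sum_univ_three, mul_comm]

/-- The ring points `(√3/2 · cos θ, √3/2 · sin θ, ±1/2)` of the decahedral-axis pattern are unit
vectors (`3/4 + 1/4 = 1`). [folklore] -/
theorem agrd_norm_ring (θ σ : ℝ) (hσ : σ = 1 / 2 ∨ σ = -(1 / 2)) :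
    ‖(!₂[Real.sqrt 3 / 2 * Real.cos θ, Real.sqrt 3 / 2 * Real.sin θ, σ] :
      EuclideanSpace ℝ (Fin 3))‖ = 1 := by
  have hσ2 : σ ^ 2 = 1 / 4 := by rcases hσ with rfl | rfl <;> norm_num
  have h3 : Real.sqrt 3 ^ 2 = 3 := Real.sq_sqrt (by norm_num)
  have hcs := Real.cos_sq_add_sin_sq θ
  have h : ‖(!₂[Real.sqrt 3 / 2 * Real.cos θ, Real.sqrt 3 / 2 * Real.sin θ, σ] :
      EuclideanSpace ℝ (Fin 3))‖ ^ 2 = 1 := by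
    rw [CleanHull.dl_norm_sq_vec3, hσ2]
    linear_combination (Real.cos θ ^ 2 + Real.sin θ ^ 2) / 4 * h3 + (3 / 4 : ℝ) * hcs
  exact (pow_eq_one_iff_of_nonneg (norm_nonneg _) two_ne_zero).1 h

/-- The poles `(0, 0, ±1)` are unit vectors. [folklore] -/
theorem agrd_norm_poles :
    ‖(!₂[(0 : ℝ), 0, 1] : EuclideanSpace ℝ (Fin 3))‖ = 1 ∧
      ‖(!₂[(0 : ℝ), 0, -1] : EuclideanSpace ℝ (Fin 3))‖ = 1 := by
  constructor
  · have h : ‖(!₂[(0 : ℝ), 0, 1] : EuclideanSpace ℝ (Fin 3))‖ ^ 2 = 1 := by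
      rw [CleanHull.dl_norm_sq_vec3]; norm_num
    exact (pow_eq_one_iff_of_nonneg (norm_nonneg _) two_ne_zero).1 h
  · have h : ‖(!₂[(0 : ℝ), 0, -1] : EuclideanSpace ℝ (Fin 3))‖ ^ 2 = 1 := by
      rw [CleanHull.dl_norm_sq_vec3]; norm_num
    exact (pow_eq_one_iff_of_nonneg (norm_nonneg _) two_ne_zero).1 h

/-! ## The decahedral-axis pattern sees every direction -/

/-- The three ring angles used: `2π·0/5 = 0`, `2π·2/5 = π − π/5`, `2π·3/5 = π/5 + π`, so their
cosines are `1, −cos(π/5), −cos(π/5)` and their sines `0, sin(π/5), −sin(π/5)`. [folklore] -/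
theorem agrd_trig :
    Real.cos (2 * Real.pi * 0 / 5) = 1 ∧ Real.sin (2 * Real.pi * 0 / 5) = 0 ∧
    Real.cos (2 * Real.pi * 2 / 5) = -Real.cos (Real.pi / 5) ∧
    Real.sin (2 * Real.pi * 2 / 5) = Real.sin (Real.pi / 5) ∧
    Real.cos (2 * Real.pi * 3 / 5) = -Real.cos (Real.pi / 5) ∧
    Real.sin (2 * Real.pi * 3 / 5) = -Real.sin (Real.pi / 5) := by
  have e0 : 2 * Real.pi * 0 / 5 = 0 := by ring
  have e2 : 2 * Real.pi * 2 / 5 = Real.pi - Real.pi / 5 := by ring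
  have e3 : 2 * Real.pi * 3 / 5 = Real.pi / 5 + Real.pi := by ring
  rw [e0, e2, e3, Real.cos_zero, Real.sin_zero, Real.cos_pi_sub, Real.sin_pi_sub, Real.cos_add_pi,
    Real.sin_add_pi]
  exact ⟨rfl, rfl, rfl, rfl, rfl, rfl⟩

/-- Numerical facts on `c = cos(π/5) = (1 + √5)/4` and `s = sin(π/5)`: `0 < c ≤ 1`,
`c² ≥ 13/20`, `s² ≥ 69/200`. [folklore] -/
theorem agrd_cos_sin_bounds :
    0 < Real.cos (Real.pi / 5) ∧ Real.cos (Real.pi / 5) ≤ 1 ∧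
      13 / 20 ≤ Real.cos (Real.pi / 5) ^ 2 ∧ 69 / 200 ≤ Real.sin (Real.pi / 5) ^ 2 := by
  have hc : Real.cos (Real.pi / 5) = (1 + Real.sqrt 5) / 4 := Real.cos_pi_div_five
  have h5 : Real.sqrt 5 ^ 2 = 5 := Real.sq_sqrt (by norm_num)
  have h50 : 0 ≤ Real.sqrt 5 := Real.sqrt_nonneg 5
  have h5lo : (2236 : ℝ) / 1000 ≤ Real.sqrt 5 := by nlinarith
  have h5hi : Real.sqrt 5 ≤ (2237 : ℝ) / 1000 := by nlinarith
  have hcs := Real.sin_sq_add_cos_sq (Real.pi / 5)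
  refine ⟨?_, Real.cos_le_one _, ?_, ?_⟩
  · rw [hc]; linarith
  · rw [hc]; nlinarith
  · rw [hc] at hcs; nlinarith

/-- **The planar/real-arithmetic core of the covering argument.** With `p = √3 u₀`, `q = √3 u₁`,
`z = u₂`, `N = ‖u‖` (so `3N² = p² + q² + 3z²`), the eight strict inequalities `5 ⟪u, v⟫ < ‖u‖`
for the two poles and the ring points at angles `0`, `4π/5`, `6π/5` (summed over the two signs of
the third coordinate) are contradictory: they force `25 z² < N²`, `25 c² p² < 4 N²`,
`25 s² q² < 16 N²`, whence `3 N² < 3 N²`. [folklore] -/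
theorem agrd_core {p q z N c s : ℝ} (hN2 : 3 * N ^ 2 = p ^ 2 + q ^ 2 + 3 * z ^ 2)
    (hc0 : 0 < c) (hc1 : c ≤ 1) (hc2 : 13 / 20 ≤ c ^ 2) (hs2 : 69 / 200 ≤ s ^ 2)
    (hz1 : 5 * z < N) (hz2 : -(5 * z) < N) (hA : 5 * p < 2 * N)
    (hB : 5 * (-(c * p) + s * q) < 2 * N) (hC : 5 * (-(c * p) - s * q) < 2 * N) : False := by
  have hz : 25 * z ^ 2 < N ^ 2 := by nlinarith
  have hA1 : 5 * (c * p) < 2 * N := by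
    rcases le_or_gt 0 p with hp | hp
    · have := mul_nonneg (sub_nonneg.2 hc1) hp
      nlinarith
    · have := mul_pos hc0 (neg_pos.2 hp)
      nlinarith
  have hA2 : -(5 * (c * p)) < 2 * N := by linarith
  have hb1 : 5 * (s * q) < 4 * N := by linarith
  have hb2 : -(5 * (s * q)) < 4 * N := by linarith
  have ha : 25 * (c ^ 2 * p ^ 2) < 4 * N ^ 2 := by
    have h1 : 0 < 2 * N - 5 * (c * p) := by linarith
    have h2 : 0 < 2 * N + 5 * (c * p) := by linarith
    nlinarith [mul_pos h1 h2]
  have hb : 25 * (s ^ 2 * q ^ 2) < 16 * N ^ 2 := by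
    have h1 : 0 < 4 * N - 5 * (s * q) := by linarith
    have h2 : 0 < 4 * N + 5 * (s * q) := by linarith
    nlinarith [mul_pos h1 h2]
  have ha' := mul_le_mul_of_nonneg_right hc2 (sq_nonneg p)
  have hb' := mul_le_mul_of_nonneg_right hs2 (sq_nonneg q)
  nlinarith [sq_nonneg p, sq_nonneg q, sq_nonneg z, sq_nonneg N]

/-- **The decahedral-axis pattern sees every direction**: for every `u ∈ ℝ³` some point `v` of the
twelve-point pattern `{±e₃} ∪ {(√3/2·cos(2πk/5), √3/2·sin(2πk/5), ±1/2)}` has `‖u‖ ≤ 5 ⟪u, v⟫`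
(only the poles and the ring points with `k = 0, 2, 3` are used). [folklore] -/
theorem agrd_dec_cover (u : EuclideanSpace ℝ (Fin 3)) :
    ∃ v ∈ {p : EuclideanSpace ℝ (Fin 3) | p = !₂[(0 : ℝ), 0, 1] ∨ p = !₂[(0 : ℝ), 0, -1] ∨ ∃ k : Fin 5, ∃ σ : ℝ, (σ = 1 / 2 ∨ σ = -(1 / 2)) ∧ p = !₂[Real.sqrt 3 / 2 * Real.cos (2 * Real.pi * (k : ℝ) / 5), Real.sqrt 3 / 2 * Real.sin (2 * Real.pi * (k : ℝ) / 5), σ]}, ‖u‖ ≤ 5 * ⟪u, v⟫ := by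
  by_contra hcon
  push Not at hcon
  simp only [Set.mem_setOf_eq] at hcon
  obtain ⟨h0c, h0s, h2c, h2s, h3c, h3s⟩ := agrd_trig
  obtain ⟨hc0, hc1, hc2, hs2⟩ := agrd_cos_sin_bounds
  have hp1 := hcon _ (Or.inl rfl)
  have hp2 := hcon _ (Or.inr (Or.inl rfl))
  have h0p := hcon _ (Or.inr (Or.inr ⟨⟨0, by norm_num⟩, 1 / 2, Or.inl rfl, rfl⟩))
  have h0m := hcon _ (Or.inr (Or.inr ⟨⟨0, by norm_num⟩, -(1 / 2), Or.inr rfl, rfl⟩))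
  have h2p := hcon _ (Or.inr (Or.inr ⟨⟨2, by norm_num⟩, 1 / 2, Or.inl rfl, rfl⟩))
  have h2m := hcon _ (Or.inr (Or.inr ⟨⟨2, by norm_num⟩, -(1 / 2), Or.inr rfl, rfl⟩))
  have h3p := hcon _ (Or.inr (Or.inr ⟨⟨3, by norm_num⟩, 1 / 2, Or.inl rfl, rfl⟩))
  have h3m := hcon _ (Or.inr (Or.inr ⟨⟨3, by norm_num⟩, -(1 / 2), Or.inr rfl, rfl⟩))
  simp only [agrd_inner_vec3, Nat.cast_ofNat, CharP.cast_eq_zero] at hp1 hp2 h0p h0m h2p h2m h3p h3m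
  rw [h0c, h0s] at h0p h0m
  rw [h2c, h2s] at h2p h2m
  rw [h3c, h3s] at h3p h3m
  have hN2 : 3 * ‖u‖ ^ 2 = (Real.sqrt 3 * u 0) ^ 2 + (Real.sqrt 3 * u 1) ^ 2 + 3 * u 2 ^ 2 := by
    rw [hge_norm_sq, mul_pow, mul_pow, Real.sq_sqrt (by norm_num : (0 : ℝ) ≤ 3)]; ring
  refine agrd_core (c := Real.cos (Real.pi / 5)) (s := Real.sin (Real.pi / 5)) hN2 hc0 hc1 hc2 hs2
    ?_ ?_ ?_ ?_ ?_
  · linarith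
  · linarith
  · linarith
  · linarith
  · linarith

/-- **The decahedral-axis pattern as a `Finset` of unit vectors seeing every direction.** The set
`{±e₃} ∪ {(√3/2·cos(2πk/5), √3/2·sin(2πk/5), ±1/2) : k ∈ Fin 5}` is finite; its `Finset` has the
same points, consists of unit vectors, is non-empty, and sees every direction. [folklore] -/
theorem agrd_dec_finset :
    ∃ P : Finset (EuclideanSpace ℝ (Fin 3)), (↑P : Set (EuclideanSpace ℝ (Fin 3))) = {p : EuclideanSpace ℝ (Fin 3) | p = !₂[(0 : ℝ), 0, 1] ∨ p = !₂[(0 : ℝ), 0, -1] ∨ ∃ k : Fin 5, ∃ σ : ℝ, (σ = 1 / 2 ∨ σ = -(1 / 2)) ∧ p = !₂[Real.sqrt 3 / 2 * Real.cos (2 * Real.pi * (k : ℝ) / 5), Real.sqrt 3 / 2 * Real.sin (2 * Real.pi * (k : ℝ) / 5), σ]} ∧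
      (∀ v ∈ P, ‖v‖ = 1) ∧ P.Nonempty ∧
      ∀ u : EuclideanSpace ℝ (Fin 3), ∃ v ∈ P, ‖u‖ ≤ 5 * ⟪u, v⟫ := by
  have hfin : Set.Finite {p : EuclideanSpace ℝ (Fin 3) | p = !₂[(0 : ℝ), 0, 1] ∨ p = !₂[(0 : ℝ), 0, -1] ∨ ∃ k : Fin 5, ∃ σ : ℝ, (σ = 1 / 2 ∨ σ = -(1 / 2)) ∧ p = !₂[Real.sqrt 3 / 2 * Real.cos (2 * Real.pi * (k : ℝ) / 5), Real.sqrt 3 / 2 * Real.sin (2 * Real.pi * (k : ℝ) / 5), σ]} := by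
    refine (((Set.finite_singleton (!₂[(0 : ℝ), 0, 1] : EuclideanSpace ℝ (Fin 3))).union
      (Set.finite_singleton (!₂[(0 : ℝ), 0, -1] : EuclideanSpace ℝ (Fin 3)))).union
      (Set.finite_range (fun kσ : Fin 5 × Bool =>
        (!₂[Real.sqrt 3 / 2 * Real.cos (2 * Real.pi * (kσ.1 : ℝ) / 5),
          Real.sqrt 3 / 2 * Real.sin (2 * Real.pi * (kσ.1 : ℝ) / 5),
          if kσ.2 then (1 : ℝ) / 2 else -(1 / 2)] : EuclideanSpace ℝ (Fin 3))))).subset ?_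
    rintro p (rfl | rfl | ⟨k, σ, hσ, rfl⟩)
    · exact Or.inl (Or.inl rfl)
    · exact Or.inl (Or.inr rfl)
    · rcases hσ with rfl | rfl
      · exact Or.inr ⟨(k, true), by simp⟩
      · exact Or.inr ⟨(k, false), by simp⟩
  refine ⟨hfin.toFinset, hfin.coe_toFinset, ?_, ?_, ?_⟩
  · intro v hv
    rw [Set.Finite.mem_toFinset] at hv
    rcases hv with rfl | rfl | ⟨k, σ, hσ, rfl⟩
    · exact agrd_norm_poles.1
    · exact agrd_norm_poles.2
    · exact agrd_norm_ring _ _ hσ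
  · exact ⟨!₂[(0 : ℝ), 0, 1], by rw [Set.Finite.mem_toFinset]; exact Or.inl rfl⟩
  · intro u
    obtain ⟨v, hv, h⟩ := agrd_dec_cover u
    exact ⟨v, by rwa [Set.Finite.mem_toFinset], h⟩

/-! ## Relative denseness -/

/-- **Relative denseness for the three-letter alphabet.** A non-empty `δ`-separated `S ⊆ ℝ³` all of
whose points are `PatternGood` for fcc, hcp or a third `Finset` pattern `P` of unit vectors seeing
every direction, with scale `≤ R₀`, has a point within `4 R₀` of every point of `ℝ³`
(`hge_relDense` with one more case). [folklore] -/
theorem agrd_relDense3 {P : Finset (EuclideanSpace ℝ (Fin 3))} (hP1 : ∀ v ∈ P, ‖v‖ = 1)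
    (hPne : P.Nonempty) (hP : ∀ u : EuclideanSpace ℝ (Fin 3), ∃ v ∈ P, ‖u‖ ≤ 5 * ⟪u, v⟫)
    {S : Set (EuclideanSpace ℝ (Fin 3))} {δ R₀ : ℝ} (hδ : 0 < δ)
    (hsep : ∀ p ∈ S, ∀ q ∈ S, p ≠ q → δ ≤ dist p q) (hne : S.Nonempty)
    (hgood : ∀ y ∈ S, PatternGood fccKissingPattern R₀ S y ∨ PatternGood hcpKissingPattern R₀ S y ∨
      PatternGood P R₀ S y) :
    ∃ R₁ : ℝ, ∀ p : EuclideanSpace ℝ (Fin 3), ∃ y ∈ S, dist y p ≤ R₁ := by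
  classical
  obtain ⟨⟨hf1, hfne⟩, ⟨hh1, hhne⟩⟩ := hge_patterns_unit_nonempty
  refine ⟨4 * R₀, fun p => ?_⟩
  obtain ⟨y₀, hy₀⟩ := hne
  -- the closest point of `S` to `p`
  have hfin : (S ∩ closedBall p (dist y₀ p)).Finite :=
    finite_of_forall_le_dist_of_subset_closedBall hδ
      (fun a ha b hb hab => hsep a ha.1 b hb.1 hab) Set.inter_subset_right
  have hmem : y₀ ∈ hfin.toFinset := by simpa using hy₀
  obtain ⟨y, hy, hmin⟩ := Finset.exists_min_image hfin.toFinset (fun y => dist y p) ⟨y₀, hmem⟩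
  simp only [Set.Finite.mem_toFinset, Set.mem_inter_iff, mem_closedBall] at hy hmin
  refine ⟨y, hy.1, ?_⟩
  by_contra hfar
  rw [not_le] at hfar
  obtain ⟨z, hz, hzlt⟩ : ∃ z ∈ S, dist z p < dist y p := by
    rcases hgood y hy.1 with h | h | h
    · exact hge_exists_closer hf1 hfne hge_fcc_cover hδ hsep hy.1 h hfar
    · exact hge_exists_closer hh1 hhne hge_hcp_cover hδ hsep hy.1 h hfar
    · exact hge_exists_closer hP1 hPne hP hδ hsep hy.1 h hfar
  have := hmin z ⟨hz, hzlt.le.trans hy.2⟩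
  linarith

/-- **STUB 3 of line `birth` — everywhere-alphabet-good sets with bounded scale are relatively
dense.**  A non-empty `δ`-separated `S ⊆ ℝ³` every point of which is alphabet-good (fcc, hcp or
decahedral-axis first shell at tolerance `1/20`, cutoff `13/10 · d_y`) with local scale `≤ R₀` has a
point within `R₁ = 4 R₀` of every point of `ℝ³`: each `y ∈ S` is `PatternGood` for one of the three
`Finset` patterns (`agrd_dec_finset` for the third), and `agrd_relDense3` applies. [folklore] -/
theorem stub_alphabetGoodRelDense : let GA : Set (EuclideanSpace ℝ (Fin 3)) → EuclideanSpace ℝ (Fin 3) → Prop := fun S y => let d : ℝ := sInf ((fun z => dist z y) '' (S \ {y})); let T : Set (EuclideanSpace ℝ (Fin 3)) := {z : EuclideanSpace ℝ (Fin 3) | z ∈ S ∧ z ≠ y ∧ dist z y < 13 / 10 * d}; ∃ A : EuclideanSpace ℝ (Fin 3) →ₗᵢ[ℝ] EuclideanSpace ℝ (Fin 3), (∃ e : ↥T ≃ ↥Literature.Geometry.DiscreteGeometry.fccKissingPattern, ∀ t : ↥T, dist (d⁻¹ • ((t : EuclideanSpace ℝ (Fin 3)) - y)) (A ((e t : ↥Literature.Geometry.DiscreteGeometry.fccKissingPattern)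 : EuclideanSpace ℝ (Fin 3))) ≤ 1 / 20) ∨ (∃ e : ↥T ≃ ↥Literature.Geometry.DiscreteGeometry.hcpKissingPattern, ∀ t : ↥T, dist (d⁻¹ • ((t : EuclideanSpace ℝ (Fin 3)) - y)) (A ((e t : ↥Literature.Geometry.DiscreteGeometry.hcpKissingPattern) : EuclideanSpace ℝ (Fin 3))) ≤ 1 / 20) ∨ (∃ e : ↥T ≃ ↥{p : EuclideanSpace ℝ (Fin 3) | p = !₂[(0 : ℝ), 0, 1] ∨ p = !₂[(0 : ℝ), 0, -1] ∨ ∃ k : Fin 5, ∃ σ : ℝ, (σ = 1 / 2 ∨ σ = -(1 / 2)) ∧ p = !₂[Real.sqrt 3 / 2 * Real.cos (2 * Real.pi * (k : ℝ) / 5), Real.sqrt 3 / 2 * Real.sin (2 * Real.pi * (k : ℝ) / 5), σ]}, ∀ t : ↥T, dist (d⁻¹ • ((t : EuclideanSpace ℝ (Fin 3)) - y)) (A ((e t : ↥{p : EuclideanSpace ℝ (Fin 3) | p = !₂[(0 : ℝ), 0, 1] ∨ p = !₂[(0 : ℝ), 0, -1] ∨ ∃ k : Fin 5, ∃ σ :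 ℝ, (σ = 1 / 2 ∨ σ = -(1 / 2)) ∧ p = !₂[Real.sqrt 3 / 2 * Real.cos (2 * Real.pi * (k : ℝ) / 5), Real.sqrt 3 / 2 * Real.sin (2 * Real.pi * (k : ℝ) / 5), σ]}) : EuclideanSpace ℝ (Fin 3))) ≤ 1 / 20); ∀ (δ R₀ : ℝ) (S : Set (EuclideanSpace ℝ (Fin 3))), 0 < δ → (∀ y ∈ S, ∀ z ∈ S, y ≠ z → δ ≤ dist y z) → S.Nonempty → (∀ y ∈ S, GA S y ∧ sInf ((fun z => dist z y) '' (S \ {y})) ≤ R₀) → ∃ R₁ : ℝ, ∀ p : EuclideanSpace ℝ (Fin 3), ∃ y ∈ S, dist y p ≤ R₁ := by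
  intro GA δ R₀ S hδ hsep hne hgood
  obtain ⟨P, hcoe, hP1, hPne, hcov⟩ := agrd_dec_finset
  refine agrd_relDense3 (R₀ := R₀) hP1 hPne hcov hδ hsep hne fun y hy => ?_
  obtain ⟨hG, hR⟩ := hgood y hy
  simp only [GA] at hG
  obtain ⟨A, h | h | h⟩ := hG
  · exact Or.inl ⟨hR, A, h⟩
  · exact Or.inr (Or.inl ⟨hR, A, h⟩)
  · obtain ⟨e, he⟩ := h
    refine Or.inr (Or.inr ⟨hR, A, e.trans (Equiv.subtypeEquivRight fun x => ?_), fun t => ?_⟩)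
    · rw [← hcoe]
      exact Finset.mem_coe
    · exact he t

end Summit.AtomisticToContinuum.Crystallization.Theorems.AlphabetGoodHullElementBirth

end
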